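import Summits.CriticalPhenomena.SAWScalingLimit.Theorems.HexTight.Negative.RingTwoSAW

/-!
# Ring counterexamples for crux `HexTight` (stmt-CriticalPhenomena-5423), part 9:
`DSR.OutwardDiveBound` (line `differentiated-sum-rule`, registered `stub_outwardDive`) is FALSE

Line lead seat c6 (2026-08-16), re-deriving the lost part 5/5 of the disprover's weighted-ring
chain (cdisprove generation 3, Disproof §7). The statement `DSR.OutwardDiveBound`
(`Negative/OutwardDiveDefs.lean`, a token-for-token copy of
`Cruxes/HexTight/Lines/differentiated-sum-rule.lean` §C) is Kemppainen–Smirnov's Condition G2 in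
CONSTANT form for OUTWARD unforced annulus crossings of the `x_c`-weighted hexagonal SAW,
quantified over ALL bounded `Ω : Set ℂ`, all meshes, endpoints and pasts. It fails in the ring:

* `Ω = Omega K` realises the ring `ring K` as the discrete domain `Ω_1` (`RingDomain`); source
  `a = U(0,0)` (bottom row), past `π = [a]`, target `b = U(0,2K)` (top row), centre `x₀ = c(a)`;
* given the constants `M > 1`, `r₀ > 0` of the statement take `r = max r₀ (2/(M-1))` (so that
  `R = M r ≥ r + 2`) and `K ≥ R`;
* the right arm `armC[K, r, R]` (bottom-row ring cells right of the centre at distance in `(r, R)`)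
  is an annulus component of `A(x₀; r, R)` (`isAnnulusComponent_armC`: closed under adjacency by the
  real-part dichotomy, connected along `U(i,0) ∼ D(i,0) ∼ U(i+1,0)`), it is UNFORCED (the left route
  `Tneg` avoids it, `unforced_armC`), and the inner ball touches the boundary at the centre
  (`innerTouches`, the cell `D(0,-1)` below the centre is off the ring);
* the rightward SAW `γR` (`exists_right_saw`, `ℓ(γR) ≤ 8K+1`) crosses `armC` outward
  (`futureCrossesOut_right`), so the left side of G2 is `≥ 2 x_c^{ℓ(γR)}`, while the right side —
  the weight of ALL SAWs — is `≤ x_c^{ℓ(γR)} + x_c^{14K-1}` (`weight_le`: the only other SAW is the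
  leftward one, `ℓ ≥ 14K-1`); `2 x_c^{ℓ(γR)} ≤ x_c^{ℓ(γR)} + x_c^{14K-1}` is false (`not_two_mul_le`).

Main result: `not_outwardDiveBoundAsTyped : ¬ DSR.OutwardDiveBound`. The registered unconditional
stub `stub_outwardDive : OutwardDiveBound` of the line `differentiated-sum-rule` is therefore
unprovable as typed (Disproof §7/§7c: the confining ring is not an artefact of the general `Ω`).
-/

noncomputable section

open scoped BigOperators ENNReal
open Classical
open Literature.Probability.LatticeModels
open Literature.Probability.RandomPlanarGeometry.SAW

namespace Summit.CriticalPhenomena.SAWScalingLimit.Cruxes.HexTight.Negative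

/-! ## The right arm of the annulus `A(x₀; r, R)` -/

/-- **The right arm** `armC[K, r, R]` (notation, local to this file): bottom-row ring cells right
of the centre (real part `≥ Re x₀ + 1/2`) at distance in the open interval `(r, R)` from `x₀`. -/
local notation3 "armC[" K ", " r ", " R "]" =>
  {y : HexVertex | y ∈ ring K ∧ y.1 1 = 0 ∧ x₀.re + 1 / 2 ≤ (hexCenter y).re ∧
    r < dist (hexCenter y) x₀ ∧ dist (hexCenter y) x₀ < R}

section Arm

variable {K : ℕ} {r R : ℝ}

/-- `U(i,0)` lies on the arm when `r < i < R` (`1 ≤ i ≤ K`) -/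
theorem U_mem_armC {i : ℤ} (hi : 1 ≤ i) (hiK : i ≤ K) (hri : r < i) (hiR : (i : ℝ) < R) :
    U i 0 ∈ (armC[K, r, R]) := by
  refine ⟨U_mem_ring.2 (Or.inl ⟨rfl, by omega, hiK⟩), rfl, ?_, ?_, ?_⟩
  · rw [x₀_re, re_U]
    have : (1 : ℝ) ≤ i := by exact_mod_cast hi
    push_cast; linarith
  · rwa [dist_U0 (by omega)]
  · rwa [dist_U0 (by omega)]

/-- `D(i,0)` lies on the arm when `r ≤ i` and `i + 1 ≤ R` (`0 ≤ i ≤ K`) -/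
theorem D_mem_armC {i : ℤ} (hi : 0 ≤ i) (hiK : i ≤ K) (hri : r ≤ i) (hiR : (i : ℝ) + 1 ≤ R) :
    D i 0 ∈ (armC[K, r, R]) := by
  refine ⟨D_mem_ring.2 (Or.inl ⟨rfl, by omega, hiK⟩), rfl, ?_, hri.trans_lt (lt_dist_D0 hi),
    (dist_D0_lt hi).trans_le hiR⟩
  rw [x₀_re, re_D]
  have : (0 : ℝ) ≤ i := by exact_mod_cast hi
  push_cast; linarith

/-- from `U(i,0)` on the arm: `r < i < R` -/
theorem of_U_mem_armC {i : ℤ} (hi : 0 ≤ i) (h : U i 0 ∈ (armC[K, r, R])) : r < i ∧ (i : ℝ) < R := by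
  obtain ⟨-, -, -, h1, h2⟩ := h
  rw [dist_U0 hi] at h1 h2
  exact ⟨h1, h2⟩

/-- from `D(i,0)` on the arm: `r < i + 1` and `i < R` -/
theorem of_D_mem_armC {i : ℤ} (hi : 0 ≤ i) (h : D i 0 ∈ (armC[K, r, R])) : r < i + 1 ∧ (i : ℝ) < R := by
  obtain ⟨-, -, -, h1, h2⟩ := h
  exact ⟨h1.trans (dist_D0_lt hi), (lt_dist_D0 hi).trans h2⟩

/-- adjacency of `Ω_1` restricted to the arm -/
theorem induce_adj {y y' : HexVertex} (hy : y ∈ (armC[K, r, R])) (hy' : y' ∈ (armC[K, r, R])) (hK : 1 ≤ K)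
    (h : hexGraph.Adj y y') :
    ((hexDomainGraph (Omega K) 1).induce (armC[K, r, R])).Adj ⟨y, hy⟩ ⟨y', hy'⟩ := by
  simp only [SimpleGraph.comap_adj, Function.Embedding.subtype_apply]
  exact (domAdj_iff hK).2 ⟨h, hy.1, hy'.1⟩

/-- **Walking along the arm.** `U(i,0)` and `U(i+n,0)` on the arm are joined inside the arm (all
intermediate `U(k,0)`, `D(k,0)` lie on it: distances are monotone along the bottom row). -/
theorem reach_U (hK : 1 ≤ K) (hRK : R ≤ K) : ∀ (n : ℕ) (i : ℤ) (hi : 1 ≤ i)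
    (h₁ : U i 0 ∈ (armC[K, r, R])) (h₂ : U (i + n) 0 ∈ (armC[K, r, R])),
    ((hexDomainGraph (Omega K) 1).induce (armC[K, r, R])).Reachable ⟨U i 0, h₁⟩ ⟨U (i + n) 0, h₂⟩
  | 0, i, hi, h₁, h₂ => by
    have : U (i + (0 : ℕ)) 0 = U i 0 := by push_cast; rw [add_zero]
    exact ⟨SimpleGraph.Walk.nil.copy rfl (by simp)⟩
  | n + 1, i, hi, h₁, h₂ => by
    obtain ⟨hr, -⟩ := of_U_mem_armC (by omega) h₁
    obtain ⟨-, hR⟩ := of_U_mem_armC (by omega) h₂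
    push_cast at hR
    have hmid : U (i + n) 0 ∈ (armC[K, r, R]) := by
      refine U_mem_armC (by omega) ?_ (by push_cast; linarith) (by push_cast; linarith)
      exact_mod_cast (show ((i + n : ℤ) : ℝ) ≤ K by push_cast; linarith)
    have hD : D (i + n) 0 ∈ (armC[K, r, R]) := by
      refine D_mem_armC (by omega) ?_ (by push_cast; linarith) (by push_cast; linarith)
      exact_mod_cast (show ((i + n : ℤ) : ℝ) ≤ K by push_cast; linarith)
    have ih := reach_U hK hRK n i hi h₁ hmid
    refine ih.trans (SimpleGraph.Adj.reachable (induce_adj hmid hD hK (adj_U_D _ _))) |>.trans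
      (SimpleGraph.Adj.reachable ?_)
    have hadj : hexGraph.Adj (D (i + n) 0) (U (i + (n + 1 : ℕ)) 0) := by
      have := adj_D_Ur (i + n) 0
      push_cast at this ⊢
      rwa [add_assoc] at this
    exact induce_adj hD h₂ hK hadj

/-- **Every arm cell is joined inside the arm to a `U`-cell of the arm with index `≥ 1`.** -/
theorem reach_some_U (hK : 1 ≤ K) (hRK : R ≤ K) (hr0 : 0 < r) (hRr : r + 2 ≤ R) {y : HexVertex}
    (hy : y ∈ (armC[K, r, R])) :
    ∃ (i : ℤ) (hi : U i 0 ∈ (armC[K, r, R])), 1 ≤ i ∧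
      ((hexDomainGraph (Omega K) 1).induce (armC[K, r, R])).Reachable ⟨y, hy⟩ ⟨U i 0, hi⟩ := by
  rcases eq_U_or_D_of_right hy.2.1 hy.2.2.1 with ⟨i, hi, rfl⟩ | ⟨i, hi, rfl⟩
  · exact ⟨i, hy, hi, SimpleGraph.Reachable.refl _⟩
  · obtain ⟨hr, hR⟩ := of_D_mem_armC hi hy
    by_cases hri : r < i
    · -- `U(i,0)` is on the arm
      have hi1 : 1 ≤ i := by
        by_contra h0
        have : i = 0 := by omega
        rw [this] at hri; push_cast at hri; linarith
      have hU : U i 0 ∈ (armC[K, r, R]) :=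
        U_mem_armC hi1 (by exact_mod_cast (show (i : ℝ) ≤ K by linarith)) hri hR
      exact ⟨i, hU, hi1, SimpleGraph.Adj.reachable (induce_adj hy hU hK (adj_U_D i 0).symm)⟩
    · -- `U(i+1,0)` is on the arm
      have hri : (i : ℝ) ≤ r := not_lt.1 hri
      have hU : U (i + 1) 0 ∈ (armC[K, r, R]) := by
        refine U_mem_armC (by omega) ?_ (by push_cast; linarith) (by push_cast; linarith)
        exact_mod_cast (show ((i + 1 : ℤ) : ℝ) ≤ K by push_cast; linarith)
      exact ⟨i + 1, hU, by omega, SimpleGraph.Adj.reachable (induce_adj hy hU hK (adj_D_Ur i 0))⟩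

/-- **The arm is connected** (inside `Ω_1`). -/
theorem preconnected_armC (hK : 1 ≤ K) (hRK : R ≤ K) (hr0 : 0 < r) (hRr : r + 2 ≤ R) :
    ((hexDomainGraph (Omega K) 1).induce (armC[K, r, R])).Preconnected := by
  rintro ⟨y, hy⟩ ⟨y', hy'⟩
  obtain ⟨i, hi, hi1, hyi⟩ := reach_some_U hK hRK hr0 hRr hy
  obtain ⟨i', hi', hi1', hyi'⟩ := reach_some_U hK hRK hr0 hRr hy'
  refine hyi.trans (SimpleGraph.Reachable.trans ?_ hyi'.symm)
  rcases le_total i i' with hii | hii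
  · obtain ⟨n, hn⟩ := Int.le.dest hii
    subst hn
    exact reach_U hK hRK n i hi1 hi hi'
  · obtain ⟨n, hn⟩ := Int.le.dest hii
    subst hn
    exact (reach_U hK hRK n i' hi1' hi' hi).symm

/-- **The arm is an annulus component** of `A(x₀; r, R)` in the slit domain of a one-cell past
`[v]` (no slit): inside the annulus a ring cell lies on the bottom row (`far_of_mem_ring`, `R ≤ K`)
and on one side of the centre (`re_dichotomy`), and adjacent cells do not change side. -/
theorem isAnnulusComponent_armC (hK : 1 ≤ K) (hRK : R ≤ K) (hr0 : 0 < r) (hRr : r + 2 ≤ R)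
    (v : HexVertex) : DSR.IsAnnulusComponent (Omega K) 1 [v] x₀ r R (armC[K, r, R]) := by
  refine ⟨fun y hy => ?_, ?_, fun y hy y' hy' hadj => ?_, preconnected_armC hK hRK hr0 hRr⟩
  · simp only [DSR.annVerts, slitSet_singleton, Set.mem_univ, true_and, pos_one, Set.mem_setOf_eq]
    exact ⟨hy.2.2.2.1, hy.2.2.2.2⟩
  · -- the cell `U(⌊r⌋₊ + 1, 0)` lies on the arm
    have h1 : (⌊r⌋₊ : ℝ) ≤ r := Nat.floor_le hr0.le
    have h2 : r < ⌊r⌋₊ + 1 := Nat.lt_floor_add_one r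
    refine ⟨U ((⌊r⌋₊ + 1 : ℕ) : ℤ) 0, U_mem_armC (by omega) ?_ (by push_cast; linarith)
      (by push_cast; linarith)⟩
    exact_mod_cast (show ((⌊r⌋₊ + 1 : ℕ) : ℝ) ≤ K by push_cast; linarith)
  · simp only [DSR.annVerts, slitSet_singleton, Set.mem_univ, true_and, pos_one,
      Set.mem_setOf_eq] at hy'
    obtain ⟨hadj', -, hy'R⟩ := domAdj_imp hadj
    have hy'0 : y'.1 1 = 0 := by
      by_contra h0
      have := far_of_mem_ring hy'R h0
      linarith [hy'.2]
    refine ⟨hy'R, hy'0, ?_, hy'.1, hy'.2⟩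
    rcases re_dichotomy hy'R (hr0.trans hy'.1) (hy'.2.trans_le hRK) with h | h
    · exact h
    · exfalso
      have h1 := (re_sub_re_of_adj hadj').1
      rw [abs_le] at h1
      linarith [hy.2.2.1, h1.1, h1.2]

/-- **The arm is unforced**: the left route `Tneg` (real parts `≤ Re x₀` or the top row) joins the
centre `U(0,0)` to `U(0,2K)` in `Ω_1` avoiding it — as a walk from the centre… -/
theorem unforced_armC (hK : 1 ≤ K) (v : HexVertex) :
    DSR.Unforced (Omega K) 1 [v] (U 0 0) (U 0 (2 * K)) (armC[K, r, R]) := by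
  obtain ⟨p, hp⟩ := domWalk_of_latticeJoined hK Tneg_subset (joined_left hK)
  refine ⟨p, fun y hy => ⟨by simp, fun hyC => ?_⟩⟩
  rcases (hp y hy).2 with h | h
  · linarith [hyC.2.2.1]
  · have := hyC.2.1; omega

/-- … and as a walk to the centre. -/
theorem unforced_armC' (hK : 1 ≤ K) (v : HexVertex) :
    DSR.Unforced (Omega K) 1 [v] (U 0 (2 * K)) (U 0 0) (armC[K, r, R]) := by
  obtain ⟨p, hp⟩ := unforced_armC (r := r) (R := R) hK v
  exact ⟨p.reverse, fun y hy => hp y (by simpa using hy)⟩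

/-- **The inner ball touches the boundary**: the centre `U(0,0)` (at distance `0 ≤ r`) has the
lattice neighbour `D(0,-1)` off the ring. -/
theorem innerTouches (hK : 1 ≤ K) (hr0 : 0 ≤ r) (v : HexVertex) :
    DSR.InnerTouchesBoundary (Omega K) 1 [v] x₀ r := by
  refine ⟨U 0 0, D 0 (0 - 1), adj_U_iff.2 (Or.inr (Or.inr rfl)), ?_, (mem_meshDomain hK).2
    (U00_mem_ring hK), by simp, fun h => ?_⟩
  · rw [pos_one, x₀, dist_self]; exact hr0
  · have := (domAdj_imp h.1).2.2
    rw [D_mem_ring] at this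
    omega

end Arm

/-! ## The rightward SAW crosses the arm outward -/

section Crossing

variable {K : ℕ} {r R : ℝ}

/-- **The crossing block of the rightward SAW.** Its support runs from the centre (distance
`0 ≤ r`) to `U(0,2K)` (distance `≥ K ≥ R`) inside `Tpos`; the block extracted by `exists_crossing`
(from a cell within `r` to a cell beyond `R`) has all its inner cells in the annulus, on the bottom
row, right of the centre: in `armC`. -/
theorem exists_arm_block (hK : 1 ≤ K) (hRK : R ≤ K) (hr0 : 0 < r) (hRr : r + 2 ≤ R)
    (γR : HexDomainSAW (Omega K) 1 (U 0 0) (U 0 (2 * K))) (hT : ∀ y ∈ γR.walk.support, y ∈ Tpos K) :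
    ∃ (l₁ l₂ l₃ : List HexVertex) (u u' w : HexVertex),
      γR.walk.support = l₁ ++ u :: u' :: l₂ ++ w :: l₃ ∧ dist (hexCenter u) x₀ ≤ r ∧
      R ≤ dist (hexCenter w) x₀ ∧ ∀ y ∈ u' :: l₂, y ∈ (armC[K, r, R]) := by
  set l := γR.walk.support with hl
  have hl0 : l ≠ [] := SimpleGraph.Walk.support_ne_nil _
  have hhead : l.head hl0 = U 0 0 := SimpleGraph.Walk.head_support _
  have hlast : l.getLast hl0 = U 0 (2 * K) := SimpleGraph.Walk.getLast_support _
  have h0 : dist (hexCenter (l.head hl0)) x₀ ≤ r := by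
    rw [hhead, x₀, dist_self]; exact hr0.le
  have h1 : R ≤ dist (hexCenter (l.getLast hl0)) x₀ := by
    rw [hlast]
    refine hRK.trans (far_of_mem_ring (U02K_mem_ring hK) ?_)
    show (2 * (K : ℤ)) ≠ 0
    omega
  obtain ⟨l₁, l₂, l₃, u, u', w, hdec, hu, hw, -, hmid⟩ :=
    exists_crossing hl0 (saw_isChain γR) (by linarith) h0 h1
  refine ⟨l₁, l₂, l₃, u, u', w, hdec, hu, hw, fun y hymem => ?_⟩
  have hyl : y ∈ l := by
    rw [hdec]
    simp only [List.mem_append, List.mem_cons]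
    rcases List.mem_cons.1 hymem with h | h
    · exact Or.inl (Or.inr (Or.inr (Or.inl h)))
    · exact Or.inl (Or.inr (Or.inr (Or.inr h)))
  obtain ⟨hyr, hyR⟩ := hmid y hymem
  have hyring : y ∈ ring K := saw_support_ring (U00_mem_ring hK) γR y hyl
  have hy0 : y.1 1 = 0 := by
    by_contra h0
    have := far_of_mem_ring hyring h0
    linarith
  refine ⟨hyring, hy0, ?_, hyr, hyR⟩
  rcases re_dichotomy hyring (hr0.trans hyr) (hyR.trans_le hRK) with h | h
  · exact h
  · exfalso
    have := (hT y hyl).2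
    linarith

/-- **The rightward SAW crosses the right arm outward** (read from its first cell on). -/
theorem futureCrossesOut_right (hK : 1 ≤ K) (hRK : R ≤ K) (hr0 : 0 < r) (hRr : r + 2 ≤ R)
    (γR : HexDomainSAW (Omega K) 1 (U 0 0) (U 0 (2 * K))) (hT : ∀ y ∈ γR.walk.support, y ∈ Tpos K) :
    DSR.FutureCrossesOut γR.walk.support 0 (armC[K, r, R]) 1 x₀ r R := by
  obtain ⟨l₁, l₂, l₃, u, u', w, hdec, hu, hw, harm⟩ := exists_arm_block hK hRK hr0 hRr γR hT
  obtain ⟨hi, hj, hk⟩ := getElem?_decomp l₁ l₂ l₃ u u' w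
  rw [← hdec] at hi hj hk
  refine ⟨l₁.length, l₁.length + (l₂.length + 2), Nat.zero_le _, by omega,
    ⟨u, hi, by rwa [pos_one]⟩, ⟨w, hj, by rwa [pos_one]⟩, fun k hk1 hk2 => ?_⟩
  obtain ⟨y, hyk, hymem⟩ := hk k hk1 hk2
  exact ⟨y, hyk, harm y hymem⟩

end Crossing

/-! ## The refutation -/

/-- **`OutwardDiveBound` is false as typed** (`= DifferentiatedSumRule.OutwardDiveBound`, the
statement of the registered unconditional stub `stub_outwardDive` of the line
`differentiated-sum-rule`; Disproof §7): in the ring domain `Ω_1 = Omega K` with source the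
centre `U(0,0)`, past `[U(0,0)]`, target `U(0,2K)`, the right arm of `A(x₀; r, M r)` is an unforced
annulus component crossed outward by the rightward SAW, which carries more than half of the total
`x_c`-weight (`2 x_c^{ℓ_R} > x_c^{ℓ_R} + x_c^{14K-1}`, `ℓ_R ≤ 8K + 1`). -/
theorem not_outwardDiveBoundAsTyped : ¬ DSR.OutwardDiveBound := by
  rintro ⟨M, r₀, hM, hr₀, h⟩
  -- radii: `r ≥ r₀`, `R = M r ≥ r + 2`
  set r : ℝ := max r₀ (2 / (M - 1)) with hr
  have hr0 : 0 < r := hr₀.trans_le (le_max_left _ _)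
  have hrr₀ : r₀ * 1 ≤ r := by rw [mul_one]; exact le_max_left _ _
  have hRr : r + 2 ≤ M * r := by
    have hM1 : 0 < M - 1 := by linarith
    have h2 : 2 / (M - 1) ≤ r := le_max_right _ _
    rw [div_le_iff₀ hM1] at h2
    nlinarith
  -- the ring size `K ≥ R`
  obtain ⟨K, hK, hRK⟩ : ∃ K : ℕ, 1 ≤ K ∧ M * r ≤ K :=
    ⟨⌈M * r⌉₊ + 1, by omega, (Nat.le_ceil _).trans (by exact_mod_cast Nat.le_succ _)⟩
  -- the rightward SAW
  obtain ⟨γR, hT, hvc⟩ := exists_right_saw hK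
  obtain ⟨tR, hRsupp⟩ := snd_eq_of_Tpos hK γR hT
  -- instantiate the bound in the ring
  have key := h (Omega K) (isBounded_Omega K) 1 one_pos (U 0 0) (U 0 (2 * K)) [U 0 0]
    (List.cons_ne_nil _ _) x₀ r hrr₀ (innerTouches hK hr0.le _) (armC[K, r, M * r])
    (isAnnulusComponent_armC hK hRK hr0 hRr _) (unforced_armC hK _)
  -- left side ≥ 2 x_c^{ℓ_R}, right side ≤ x_c^{ℓ_R} + x_c^{14K-1}
  have hmem : γR ∈ {γ : HexDomainSAW (Omega K) 1 (U 0 0) (U 0 (2 * K)) |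
      [U 0 0] <+: γ.walk.support ∧
        DSR.FutureCrossesOut γ.walk.support ([U 0 0].length - 1) (armC[K, r, M * r]) 1 x₀ r
          (M * r)} :=
    ⟨⟨D 0 0 :: tR, by rw [hRsupp]; rfl⟩, futureCrossesOut_right hK hRK hr0 hRr γR hT⟩
  have h1 := le_weight_of_mem hmem
  have h2 := weight_le hK hRsupp
    {γ : HexDomainSAW (Omega K) 1 (U 0 0) (U 0 (2 * K)) | [U 0 0] <+: γ.walk.support}
  exact not_two_mul_le hK hvc ((mul_le_mul_right h1 2).trans (key.trans h2))

end Summit.CriticalPhenomena.SAWScalingLimit.Cruxes.HexTight.Negative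

end
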